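import Literature.NumberTheory.GelbartRogawski1991.FinLocalSplittingsSplitSpherical
import Literature.RepresentationTheory.HeisenbergGroup.SchrodingerConjugateTorusSphericalCoeff
import Literature.NumberTheory.Automorphic.SchwartzBruhatL2Norm
import HarnessLib

/-!
# The spherical MATRIX COEFFICIENTS of the local Weil representation of `U(J)` at a split place along the centre:
# `⟨ω_v(z₁^j · 1_N) 1_{𝒪_vᴺ}, 1_{𝒪_vᴺ}⟩ = μ(𝒪_vᴺ) · u^j · q_v^{-N|j|/2}` for an `L²`-isometric family of local splittings

Topic `NumberTheory/GelbartRogawski1991`; namespace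
`Literature.NumberTheory.GelbartRogawski1991.UnitaryDualPair.LocalSplitting.FinLocalSplittings`.  KERNEL ONLY: theorems, no
definition, no named fact, no `sorry`.  Sequel of `FinLocalSplittingsSplitSpherical.lean` (§1: from a Darboux conjugation of `ι_v` into the
Siegel Levi the spherical SHIFT BASIS `b j = ω_v(z₁·1_N)^j 1_{𝒪_vᴺ}`) and of ★
`HeisenbergGroup/SchrodingerConjugateTorusSphericalCoeff.lean` (the matrix coefficients of that basis against `1_{𝒪^ι}` for ISOMETRIC
implementers): for a restricted family `𝓢` of local splittings `s_v : U(J)(F_v) →* S̃p_{ψ_v}(𝕎_v)` ([GelbartRogawski1991, §3.1 Prop. 3.1.1])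
whose local Weil representation `ω_v = toRep ∘ s_v` is `L²`-ISOMETRIC (unitary — [Weil1964, Chap. I n° 13]; the tree's CM families:
★ `isL2Isometric_omegaLoc_finLocalSplittingsCM`), at a place `v` with Darboux data `ι_v(z₁ · 1_N) = γ⁻¹ m(t · 1) γ`, `|t|_v = q_v⁻¹`, `γ`
preserving the box `𝒪_vᴺ × 𝒪_vᴺ` (the split places: ★ `LocalUnitarySplitPlaceDarboux`, `FinLocalSplittingsSplitSphericalDarboux`):

* **`exists_unit_sphericalCoeff_of_iota_localCenter_eq`** — there is `u ∈ ℂ`, `|u| = 1`, with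
  `∫ (ω_v(z₁^j · 1_N) 1_{𝒪_vᴺ}) · conj 1_{𝒪_vᴺ} dμ'^N = μ'^N(𝒪_vᴺ) · u^j · ((√(q_v^N))⁻¹)^{|j|}` for every `j ∈ ℤ` — EXACTLY the hypothesis
  `hcoef` of ★ `Li1992/RallisLocalFactorSplitUnramified.integral_localFactor_unitVec_of_sphericalCoeff` (with `C = μ'^N(𝒪_vᴺ) ≠ 0`,
  `r = (√(q_v^N))⁻¹ ∈ [0,1)`), i.e. the split unramified LOCAL FACTOR of [Li1992, (27)] for the pair `(U(J), U(J₁))` is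
  `vol(U(J₁)(𝒪_v)) · μ(𝒪_vᴺ) · (1 − q_v^{-N}) ∕ |1 − u conj χ_v(z₁) q_v^{-N/2}|² ≠ 0`.

Cell hodgecm-mathlib, FLOOR 0, programme P4 (F4), crux item H413 (`--supports stmt-HodgeConjecture-24833`).  HC_CM is proved only modulo the
printed citations until rung 0 closes; nothing here is a claim about them.

## References
* [GelbartRogawski1991] S. Gelbart, J. Rogawski, Invent. Math. 105 (1991), §3.1 (3.1.3) p. 456, §3.2 p. 457.
* [MoeglinVignerasWaldspurger1987] C. Mœglin, M.-F. Vignéras, J.-L. Waldspurger, LNM 1291 (1987), Chap. 2 II.1, II.10, III.1.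
* [Weil1964] A. Weil, Acta Math. 111 (1964), Chap. I n° 13.
* [Li1992] J.-S. Li, J. reine angew. Math. 428 (1992), Thm 2.1 (27) p. 184; §5 p. 206.
-/

set_option autoImplicit false

noncomputable section

open scoped Matrix NNReal ValuativeRel ComplexConjugate
open NumberField IsDedekindDomain Filter Set MeasureTheory
open Literature.NumberTheory.Automorphic Literature.NumberTheory.Automorphic.UnitaryGroup
open Literature.RepresentationTheory.HeisenbergGroup
open Literature.NumberTheory.GaloisRepresentations.IsNonarchimedeanLocalField

namespace Literature.NumberTheory.GelbartRogawski1991.UnitaryDualPair.LocalSplitting.FinLocalSplittings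

variable {F : Type} [Field F] [NumberField F] {E : Type} [Field E] [NumberField E] [Algebra F E]
  [Algebra.IsQuadraticExtension F E] {c : E ≃ₐ[F] E} {N : ℕ} {δ : E} {hcδ : c δ = -δ} {hδ : δ ≠ 0} {d : F}
  {hd : δ * δ = algebraMap F E d} {T : Matrix (Fin N) (Fin N) F} {hT : T.IsSymm}
  {J : Matrix (Fin N) (Fin N) E} {hJ : J = T.map (algebraMap F E)}
  (𝓢 : FinLocalSplittings F E c N hcδ hδ hd T hT hJ) (J₁ : Matrix (Fin 1) (Fin 1) E) (hJ₁ : J₁ 0 0 ≠ 0)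
  (hTd : IsUnit T.det) (v : HeightOneSpectrum (𝓞 F))

include hTd in
/-- **THE SPHERICAL MATRIX COEFFICIENTS AT A PLACE WITH DARBOUX DATA, `ω_v` UNITARY.**  Let `γ ∈ Sp(𝕎_v)` preserve the box
`𝒪_vᴺ × 𝒪_vᴺ`, `a₀ = t · 1` with `|t|_v = q_v⁻¹`, `z₁ ∈ U(J₁)(F_v)` with `ι_v(z₁ · 1_N) = γ⁻¹ m(a₀) γ` (local unramifiedness data: `ψ_v` of
conductor `𝒪_v`, `2 ∈ 𝒪_v^×`, `T^{±1}` `v`-integral, `N ≥ 1`), and let `ω_v = toRep ∘ s_v` be `L²(μ'^N)`-isometric.  Then for some `u ∈ ℂ`,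
`|u| = 1`: `∫ (ω_v(z₁^j · 1_N) 1_{𝒪_vᴺ}) conj 1_{𝒪_vᴺ} dμ'^N = μ'^N(𝒪_vᴺ) · u^j · ((√(q_v^N))⁻¹)^{|j|}` for all `j ∈ ℤ`.
[cite: GelbartRogawski1991, §3.1 (3.1.3) p. 456, §3.2 p. 457] [cite: MoeglinVignerasWaldspurger1987, Chap. 2 II.1, II.10]
[cite: Weil1964, Chap. I n° 13] -/
theorem exists_unit_sphericalCoeff_of_iota_localCenter_eq [NeZero N]
    (hcond : (adeleAddCharAt F v).HasConductorExp 0)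
    (h2 : (⅟(2 : v.adicCompletion F) : v.adicCompletion F) ∈ v.adicCompletionIntegers F)
    (hTi : ∀ i j, localGram F N T v i j ∈ primePowBall (v.adicCompletion F) 0)
    (hTi' : ∀ i j, (localGram F N T v)⁻¹ i j ∈ primePowBall (v.adicCompletion F) 0)
    (γ : LocalSp F N T v)
    (hγ : ∀ p ∈ (piPrimePowBall (v.adicCompletion F) (Fin N) 0) ×ˢ (piPrimePowBall (v.adicCompletion F) (Fin N) 0),
      (γ : ((Fin N → v.adicCompletion F) × (Fin N → v.adicCompletion F)) ≃ₗ[v.adicCompletion F]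
        ((Fin N → v.adicCompletion F) × (Fin N → v.adicCompletion F))) p ∈
        (piPrimePowBall (v.adicCompletion F) (Fin N) 0) ×ˢ (piPrimePowBall (v.adicCompletion F) (Fin N) 0))
    {t : v.adicCompletion F} (ht : normAbs (v.adicCompletion F) t = (residueFieldCard (v.adicCompletion F) : ℝ≥0)⁻¹)
    {a₀ : GL (Fin N) (v.adicCompletion F)} (ha₀ : (a₀ : Matrix (Fin N) (Fin N) (v.adicCompletion F)) = t • 1)
    (z₁ : localPi E c 1 J₁ v)
    (hcenter : iota F E c N hcδ hδ hd T hT hJ v (localCenter E c N J J₁ hJ₁ v z₁) =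
      γ⁻¹ * SymplecticMatrix.transportSp (localGram F N T v) (isUnit_det_localGram F N T hTd v)
        (SymplecticMatrix.levi a₀) * γ)
    [MeasurableSpace (v.adicCompletion F)] [BorelSpace (v.adicCompletion F)] (μ' : Measure (v.adicCompletion F))
    [μ'.IsAddHaarMeasure] (hL2 : (𝓢.omegaLoc v).IsL2Isometric (Measure.pi fun _ : Fin N => μ')) :
    ∃ u : ℂ, ‖u‖ = 1 ∧ ∀ j : ℤ,
      ∫ x, ((𝓢.omegaLoc v (localCenter E c N J J₁ hJ₁ v (z₁ ^ j)) (unitVec F (Fin N) v) :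
            SchwartzBruhat (Fin N → v.adicCompletion F)) : (Fin N → v.adicCompletion F) → ℂ) x *
          conj (((unitVec F (Fin N) v : SchwartzBruhat (Fin N → v.adicCompletion F)) : (Fin N → v.adicCompletion F) → ℂ) x)
          ∂(Measure.pi fun _ : Fin N => μ') =
        ((Measure.pi fun _ : Fin N => μ').real (piPrimePowBall (v.adicCompletion F) (Fin N) 0) : ℂ) * u ^ j *
          (((Real.sqrt ((residueFieldCard (v.adicCompletion F) : ℝ) ^ Fintype.card (Fin N)))⁻¹ : ℝ) : ℂ) ^ j.natAbs := by
  have hbT : ∀ y : Fin N → v.adicCompletion F, Continuous fun u : Fin N → v.adicCompletion F =>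
      localPairing F N T v u y := fun y => by
    simp only [Matrix.toLinearMap₂'_apply', dotProduct]
    exact continuous_finsetSum _ fun i _ => (continuous_apply i).mul continuous_const
  -- the implementer `M = s_v(z₁ · 1_N)` of the conjugate torus element, as the value of a homomorphism into the linear automorphisms
  let φ : localPi E c 1 J₁ v →* (SchwartzBruhat (Fin N → v.adicCompletion F) ≃ₗ[ℂ] SchwartzBruhat (Fin N → v.adicCompletion F)) :=
    (MonoidHom.snd _ _).comp (((MpPsi (localSchrodinger F N T v)).subtype).comp ((𝓢.s v).comp (localCenter E c N J J₁ hJ₁ v)))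
  have hφ : ∀ z : localPi E c 1 J₁ v, φ z = ((𝓢.s v (localCenter E c N J J₁ hJ₁ v z) : LocalMp F N T v) : LocalSp F N T v ×
      (SchwartzBruhat (Fin N → v.adicCompletion F) ≃ₗ[ℂ] SchwartzBruhat (Fin N → v.adicCompletion F))).2 := fun _ => rfl
  have hM : Implements (localSchrodinger F N T v) (ofSymplectic _
      (γ⁻¹ * SymplecticMatrix.transportSp (localGram F N T v) (isUnit_det_localGram F N T hTd v)
        (SymplecticMatrix.levi a₀) * γ)) (φ z₁) := by
    rw [hφ, ← hcenter]; exact 𝓢.implements_snd_s v _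
  have hMiso : ∀ Φ, SchwartzBruhat.l2NormSq (Measure.pi fun _ : Fin N => μ') (φ z₁ Φ) =
      SchwartzBruhat.l2NormSq (Measure.pi fun _ : Fin N => μ') Φ := fun Φ => by
    rw [hφ, ← 𝓢.omegaLoc_eq_snd_apply v]; exact hL2.l2NormSq_apply _ Φ
  -- the powers: `ω_v(z₁^j · 1_N) Φ = (M^j) Φ`
  have hpow : ∀ (j : ℤ) (Φ : SchwartzBruhat (Fin N → v.adicCompletion F)),
      𝓢.omegaLoc v (localCenter E c N J J₁ hJ₁ v (z₁ ^ j)) Φ = ((φ z₁) ^ j) Φ := fun j Φ => by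
    rw [𝓢.omegaLoc_eq_snd_apply v, ← hφ, map_zpow]
  obtain ⟨u, hu, h⟩ := exists_unit_integral_zpow_apply_integersIndicator_mul_conj_of_mapsTo (localGram F N T v)
    (isUnit_det_localGram F N T hTd v) (isLocallyConstant_of_isContinuousNontrivial (isContinuousNontrivial_adeleAddCharAt F v)) hbT
    (unitVec F (Fin N) v) (coe_unitVec_eq_indicator_piPrimePowBall F N v) μ' (isContinuousNontrivial_adeleAddCharAt F v) hcond
    ((mem_primePowBall_zero_iff _).2 h2) hTi hTi' γ hγ ht ha₀ hM hMiso
  refine ⟨u, hu, fun j => ?_⟩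
  simp_rw [hpow j]
  exact h j


/-- **orientation flip for the coefficients**: the spherical coefficients along `z⁻¹` with unit `u` are the spherical coefficients along `z`
with unit `u⁻¹` (`ω_v((z⁻¹)^{-j}) = ω_v(z^j)`, `|−j| = |j|`). [cite: GelbartRogawski1991, §3.2 p. 457] -/
theorem exists_unit_sphericalCoeff_of_inv [MeasurableSpace (v.adicCompletion F)] (μ' : Measure (v.adicCompletion F))
    (z : localPi E c 1 J₁ v) {C : ℂ} {r : ℝ}
    (h : ∃ u : ℂ, ‖u‖ = 1 ∧ ∀ j : ℤ,
      ∫ x, ((𝓢.omegaLoc v (localCenter E c N J J₁ hJ₁ v (z⁻¹ ^ j)) (unitVec F (Fin N) v) :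
            SchwartzBruhat (Fin N → v.adicCompletion F)) : (Fin N → v.adicCompletion F) → ℂ) x *
          conj (((unitVec F (Fin N) v : SchwartzBruhat (Fin N → v.adicCompletion F)) : (Fin N → v.adicCompletion F) → ℂ) x)
          ∂(Measure.pi fun _ : Fin N => μ') = C * u ^ j * (r : ℂ) ^ j.natAbs) :
    ∃ u : ℂ, ‖u‖ = 1 ∧ ∀ j : ℤ,
      ∫ x, ((𝓢.omegaLoc v (localCenter E c N J J₁ hJ₁ v (z ^ j)) (unitVec F (Fin N) v) :
            SchwartzBruhat (Fin N → v.adicCompletion F)) : (Fin N → v.adicCompletion F) → ℂ) x *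
          conj (((unitVec F (Fin N) v : SchwartzBruhat (Fin N → v.adicCompletion F)) : (Fin N → v.adicCompletion F) → ℂ) x)
          ∂(Measure.pi fun _ : Fin N => μ') = C * u ^ j * (r : ℂ) ^ j.natAbs := by
  obtain ⟨u, hu, hj⟩ := h
  refine ⟨u⁻¹, by rw [norm_inv, hu, inv_one], fun j => ?_⟩
  have h1 := hj (-j)
  rw [inv_zpow', neg_neg, Int.natAbs_neg, zpow_neg, ← inv_zpow] at h1
  exact h1

include hTd in
/-- **THE SPHERICAL COEFFICIENTS AT A PLACE FOR EVERY GENERATOR `z₀`, FROM SPLIT-PLACE DARBOUX DATA AT `w ∣ v`** (both orientations):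
given `γ ∈ Sp(𝕎_v)` preserving the box, a coordinate `t : U(J₁)(F_v) → F_v` with `|t z|_w = |z_w|` and `ι_v(z · 1_N) = γ⁻¹ m(t z · 1) γ` for
all `z`, the dichotomy `|z₀,w| = q^{∓1}` for generators, and `ω_v` `L²(μ'^N)`-isometric: every generator `z₀` of `U(J₁)(F_v)/U(J₁)(𝒪_v)` has
spherical matrix coefficients `μ'^N(𝒪_vᴺ) · u^j · ((√(q_v^N))⁻¹)^{|j|}` with `|u| = 1`.
[cite: GelbartRogawski1991, §3.1 (3.1.3) p. 456, §3.2 p. 457] [cite: MoeglinVignerasWaldspurger1987, Chap. 2 II.10, III.1] -/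
theorem forall_exists_unit_sphericalCoeff_of_darboux [NeZero N]
    (hcond : (adeleAddCharAt F v).HasConductorExp 0)
    (h2 : (⅟(2 : v.adicCompletion F) : v.adicCompletion F) ∈ v.adicCompletionIntegers F)
    (hTi : ∀ i j, localGram F N T v i j ∈ primePowBall (v.adicCompletion F) 0)
    (hTi' : ∀ i j, (localGram F N T v)⁻¹ i j ∈ primePowBall (v.adicCompletion F) 0)
    (w : PlacesOver E v) (γ : LocalSp F N T v)
    (hγ : ∀ p ∈ (piPrimePowBall (v.adicCompletion F) (Fin N) 0) ×ˢ (piPrimePowBall (v.adicCompletion F) (Fin N) 0),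
      (γ : ((Fin N → v.adicCompletion F) × (Fin N → v.adicCompletion F)) ≃ₗ[v.adicCompletion F]
        ((Fin N → v.adicCompletion F) × (Fin N → v.adicCompletion F))) p ∈
        (piPrimePowBall (v.adicCompletion F) (Fin N) 0) ×ˢ (piPrimePowBall (v.adicCompletion F) (Fin N) 0))
    (t : localPi E c 1 J₁ v → v.adicCompletion F)
    (ht : ∀ z : localPi E c 1 J₁ v, Valued.v (t z) =
      Valued.v ((((z : localPi E c 1 J₁ v) : LocalGLPi E 1 v) w : Matrix (Fin 1) (Fin 1) (w.1.adicCompletion E)) 0 0))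
    (hcenter : ∀ (z : localPi E c 1 J₁ v) (a₀ : GL (Fin N) (v.adicCompletion F)),
      (a₀ : Matrix (Fin N) (Fin N) (v.adicCompletion F)) = t z • 1 →
      iota F E c N hcδ hδ hd T hT hJ v (localCenter E c N J J₁ hJ₁ v z) =
        γ⁻¹ * SymplecticMatrix.transportSp (localGram F N T v) (isUnit_det_localGram F N T hTd v)
          (SymplecticMatrix.levi a₀) * γ)
    (hgen : ∀ z₀ : localPi E c 1 J₁ v,
      (∀ h : localPi E c 1 J₁ v, ∃ (k₀ : localPi E c 1 J₁ v) (m : ℤ), k₀ ∈ localInt E c 1 J₁ v ∧ h = k₀ * z₀ ^ m) →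
      Valued.v ((((z₀ : localPi E c 1 J₁ v) : LocalGLPi E 1 v) w : Matrix (Fin 1) (Fin 1) (w.1.adicCompletion E)) 0 0) =
          WithZero.exp (-1) ∨
        Valued.v ((((z₀ : localPi E c 1 J₁ v) : LocalGLPi E 1 v) w : Matrix (Fin 1) (Fin 1) (w.1.adicCompletion E)) 0 0) =
          WithZero.exp 1)
    [MeasurableSpace (v.adicCompletion F)] [BorelSpace (v.adicCompletion F)] (μ' : Measure (v.adicCompletion F))
    [μ'.IsAddHaarMeasure] (hL2 : (𝓢.omegaLoc v).IsL2Isometric (Measure.pi fun _ : Fin N => μ'))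
    (z₀ : localPi E c 1 J₁ v)
    (hz₀ : ∀ h : localPi E c 1 J₁ v, ∃ (k₀ : localPi E c 1 J₁ v) (m : ℤ), k₀ ∈ localInt E c 1 J₁ v ∧ h = k₀ * z₀ ^ m) :
    ∃ u : ℂ, ‖u‖ = 1 ∧ ∀ j : ℤ,
      ∫ x, ((𝓢.omegaLoc v (localCenter E c N J J₁ hJ₁ v (z₀ ^ j)) (unitVec F (Fin N) v) :
            SchwartzBruhat (Fin N → v.adicCompletion F)) : (Fin N → v.adicCompletion F) → ℂ) x *
          conj (((unitVec F (Fin N) v : SchwartzBruhat (Fin N → v.adicCompletion F)) : (Fin N → v.adicCompletion F) → ℂ) x)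
          ∂(Measure.pi fun _ : Fin N => μ') =
        ((Measure.pi fun _ : Fin N => μ').real (piPrimePowBall (v.adicCompletion F) (Fin N) 0) : ℂ) * u ^ j *
          (((Real.sqrt ((residueFieldCard (v.adicCompletion F) : ℝ) ^ Fintype.card (Fin N)))⁻¹ : ℝ) : ℂ) ^ j.natAbs := by
  -- the core at a `z` whose coordinate has valuation `exp (-1)`
  have core : ∀ z : localPi E c 1 J₁ v, Valued.v (t z) = WithZero.exp (-1) →
      ∃ u : ℂ, ‖u‖ = 1 ∧ ∀ j : ℤ,
        ∫ x, ((𝓢.omegaLoc v (localCenter E c N J J₁ hJ₁ v (z ^ j)) (unitVec F (Fin N) v) :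
              SchwartzBruhat (Fin N → v.adicCompletion F)) : (Fin N → v.adicCompletion F) → ℂ) x *
            conj (((unitVec F (Fin N) v : SchwartzBruhat (Fin N → v.adicCompletion F)) : (Fin N → v.adicCompletion F) → ℂ) x)
            ∂(Measure.pi fun _ : Fin N => μ') =
          ((Measure.pi fun _ : Fin N => μ').real (piPrimePowBall (v.adicCompletion F) (Fin N) 0) : ℂ) * u ^ j *
            (((Real.sqrt ((residueFieldCard (v.adicCompletion F) : ℝ) ^ Fintype.card (Fin N)))⁻¹ : ℝ) : ℂ) ^ j.natAbs := by
    intro z hz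
    have hnorm : normAbs (v.adicCompletion F) (t z) = (residueFieldCard (v.adicCompletion F) : ℝ≥0)⁻¹ := by
      rw [normAbs_eq_inv_zpow_of_valued_eq v hz, neg_neg, zpow_one]
    have ht0 : t z ≠ 0 := fun h0 => by
      rw [h0, map_zero] at hnorm; exact (inv_ne_zero (Nat.cast_ne_zero.2 (residueFieldCard_ne_zero _))) hnorm.symm
    let a₀ : GL (Fin N) (v.adicCompletion F) :=
      Units.map (algebraMap (v.adicCompletion F) (Matrix (Fin N) (Fin N) (v.adicCompletion F))).toMonoidHom
        (Units.mk0 (t z) ht0)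
    have ha₀ : (a₀ : Matrix (Fin N) (Fin N) (v.adicCompletion F)) = t z • 1 := by
      change algebraMap (v.adicCompletion F) (Matrix (Fin N) (Fin N) (v.adicCompletion F)) (t z) = _
      exact Algebra.algebraMap_eq_smul_one (t z)
    exact 𝓢.exists_unit_sphericalCoeff_of_iota_localCenter_eq J₁ hJ₁ hTd v hcond h2 hTi hTi' γ hγ hnorm ha₀ z
      (hcenter z a₀ ha₀) μ' hL2
  rcases hgen z₀ hz₀ with hneg | hpos
  · exact core z₀ ((ht z₀).trans hneg)
  · -- `|z₀,w| = q`: run the core at `z₀⁻¹` and flip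
    refine 𝓢.exists_unit_sphericalCoeff_of_inv J₁ hJ₁ v μ' z₀ (core z₀⁻¹ ?_)
    rw [ht z₀⁻¹, valued_coe_inv_apply J₁ v z₀ w, hpos, ← WithZero.exp_neg]

end Literature.NumberTheory.GelbartRogawski1991.UnitaryDualPair.LocalSplitting.FinLocalSplittings

end
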